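import Summits.CriticalPhenomena.SAWScalingLimit.Theorems.SAWDevelopingMapObservableToSLETypeLadderCarvedReductionSqueezeLinkPolyline
import HarnessLib

/-!
# Removed-set-avoiding pinned walks stay inside the envelope and off the corridor zones,
# eventually and uniformly (piece (T-A′ reach-0) of stub T-A′
# `stub_carvedReduction_squeezeGeometry_domains`)

Crux `SAWDevelopingMap.ObservableToSLE` (stmt-CriticalPhenomena-10472), line `six-class-type-ladder`,
stub T-A′ `stub_carvedReduction_squeezeGeometry_domains`.  Landing target:
`Summits/CriticalPhenomena/SAWScalingLimit/Theorems/SAWDevelopingMapObservableToSLETypeLadderCarvedReductionSqueezeWalkOffZones.lean`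
(`--supports stmt-CriticalPhenomena-10472`; registered carrier `stub_carvedReduction_walkOffZones`).
Sequel of `…SqueezeLinkPolyline` (`joinedIn_of_walk`).

Both the bulk LINK of the framed super-domain (the middle section of the realised SAW,
`…SqueezeMiddleWalk`) and the reach clause (R) of STAGE 2 (every vertex of a `U_j`-avoiding walk
of `Ω_{s_j}` from the gate, pinned, lies in `E` — via the `JoinedIn` characterisation of
`stub_carvedReduction_superFrame`) need ONE uniform statement: eventually in `j`, for EVERY walk
of the domain graph `Ω_{s_j}` all of whose vertices are present (off `U_j`), every pinned vertex
`π_j y = s_j c_y - s_j · triEmbed x_j` and every pinned edge lies in the envelope `Jset` and off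
* the EXIT ZONES `Fset` (a bounded set whose closure misses `closure (Ω - τ)`; the pinned frame
  drifts by `τ_j - τ → 0` and edges of `Ω_s` lie in `closure Ω`),
* the BODY ZONES `{infDist · (B i) < r i}` (`r i < m`; the `m`-neighbourhood of the level sets
  `Bp i j → B i` is removed, present vertices are `> m` off it, edges have length `≤ s_j`),
* the closed LOWER HALF-BALLS `{im ≤ im (P i)} ∩ closedBall (P i) (R₁ - μ)` of the windows
  (present vertices of `ball (P i) R₁` lie strictly above the gate line — `…SqueezeGateHalfBall`),
and hence its pinned endpoints are `JoinedIn` the complement; moreover every point within `κ s_j` of a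
present pinned vertex is in `Jset`, off `Fset` and `≥ r i` off the bodies (for the `25 s_j`-discs
of (R)) (`stub_carvedReduction_walkOffZones`).
-/

noncomputable section

open scoped Topology
open Filter Set Metric Bornology
open Literature.Probability.LatticeModels (HexVertex hexGraph hexCenter triEmbed Site)
open Literature.Probability.RandomPlanarGeometry
open Literature.Probability.RandomPlanarGeometry.SAW

namespace Summit.CriticalPhenomena.SAWScalingLimit.Theorems.ObservableToSLE.TypeLadder

open Summit.CriticalPhenomena.SAWScalingLimit.Theorems.ObservableToSLER.TwoPiece (dist_smul_hexCenter_le_of_adj)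

/-- Vertices of a walk of the domain graph `Ω_t` whose first vertex has its rescaled centre in
`closure Ω` all have their rescaled centres in `closure Ω` (edges of `Ω_t` are segments of
`closure Ω`). -/
theorem smul_hexCenter_mem_closure_of_walk {Ω : Set ℂ} {t : ℝ} {a b : HexVertex}
    (w : (hexDomainGraph Ω t).Walk a b) (ha : (t : ℂ) * hexCenter a ∈ closure Ω) :
    ∀ y ∈ w.support, (t : ℂ) * hexCenter y ∈ closure Ω := by
  induction w with
  | nil => simpa using ha
  | @cons u v c hadj p ih =>
    intro y hy
    rw [SimpleGraph.Walk.support_cons, List.mem_cons] at hy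
    rcases hy with rfl | hy
    · exact ha
    · have hv : (t : ℂ) * hexCenter v ∈ closure Ω :=
        ((embMeshGraph_adj_iff hexGraph hexCenter).1 ((embDomainGraph_adj_iff hexGraph hexCenter).1 hadj).1).2
          (right_mem_segment ℝ _ _)
      exact ih hv y hy

/-- Edges of the domain graph `Ω_t` are segments of `closure Ω` of length `≤ t` between
`hexGraph`-neighbours. -/
theorem segment_subset_closure_of_adj {Ω : Set ℂ} {t : ℝ} (ht : 0 ≤ t) {u v : HexVertex}
    (h : (hexDomainGraph Ω t).Adj u v) :
    segment ℝ ((t : ℂ) * hexCenter u) ((t : ℂ) * hexCenter v) ⊆ closure Ω ∧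
      dist ((t : ℂ) * hexCenter u) ((t : ℂ) * hexCenter v) ≤ t := by
  obtain ⟨hmesh, -, -⟩ := (embDomainGraph_adj_iff hexGraph hexCenter).1 h
  obtain ⟨hadj, hseg⟩ := (embMeshGraph_adj_iff hexGraph hexCenter).1 hmesh
  exact ⟨hseg, dist_smul_hexCenter_le_of_adj ht hadj⟩

/-- **Registered carrier `stub_carvedReduction_walkOffZones`** (crux item stmt-CriticalPhenomena-10472,
stub T-A′ `stub_carvedReduction_squeezeGeometry_domains`, piece PRESENT WALKS OFF THE CORRIDOR
ZONES); see the module docstring.  `π_j y` is written `s_j c_y - s_j · triEmbed x_j`. -/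
theorem stub_carvedReduction_walkOffZones :
    ∀ (Ω Jset Fset : Set ℂ) (s : ℕ → ℝ) (x : ℕ → Site 2) (U : ℕ → Set HexVertex) (τ : ℂ)
      (B : Fin 2 → Set ℂ) (Bp : Fin 2 → ℕ → Set ℂ) (r : Fin 2 → ℝ) (m : ℝ) (P : Fin 2 → ℂ) (R₁ μ κ : ℝ),
      (∀ j, 0 < s j) → Tendsto s atTop (𝓝 0) →
      Tendsto (fun j => (s j : ℂ) * triEmbed (x j)) atTop (𝓝 τ) →
      IsBounded Ω → IsOpen Jset → closure ((fun z => z - τ) '' Ω) ⊆ Jset →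
      IsBounded Fset → Disjoint (closure Fset) (closure ((fun z => z - τ) '' Ω)) →
      (∀ i j (v : HexVertex), infDist ((s j : ℂ) * hexCenter v - (s j : ℂ) * triEmbed (x j)) (Bp i j) ≤ m → v ∈ U j) →
      (∀ i, Tendsto (fun j => hausdorffDist (Bp i j) (B i)) atTop (𝓝 0)) →
      (∀ i j, (Bp i j).Nonempty) → (∀ i j, IsBounded (Bp i j)) → (∀ i, (B i).Nonempty) → (∀ i, IsBounded (B i)) →
      (∀ i, r i < m) → 0 < μ → 1 ≤ κ →
      (∀ i, ∀ᶠ j in atTop, ∀ v : HexVertex, (s j : ℂ) * hexCenter v - (s j : ℂ) * triEmbed (x j) ∈ ball (P i) R₁ →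
        v ∉ U j → (P i).im < ((s j : ℂ) * hexCenter v - (s j : ℂ) * triEmbed (x j)).im) →
      ∀ᶠ j in atTop, ∀ (a b : HexVertex) (w : (hexDomainGraph Ω (s j)).Walk a b),
        (∀ y ∈ w.support, y ∉ U j) → (s j : ℂ) * hexCenter a ∈ closure Ω →
        (∀ y ∈ w.support, ∀ p : ℂ, dist p ((s j : ℂ) * hexCenter y - (s j : ℂ) * triEmbed (x j)) ≤ κ * s j →
          p ∈ Jset ∧ p ∉ Fset ∧ ∀ i, r i ≤ infDist p (B i)) ∧
        (∀ y ∈ w.support, (s j : ℂ) * hexCenter y - (s j : ℂ) * triEmbed (x j) ∈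
          Jset \ (Fset ∪ (⋃ i, {z : ℂ | infDist z (B i) < r i}) ∪
            ⋃ i, ({z : ℂ | z.im ≤ (P i).im} ∩ closedBall (P i) (R₁ - μ)))) ∧
        (∀ y ∈ w.support, ∀ y' ∈ w.support, (hexDomainGraph Ω (s j)).Adj y y' →
          segment ℝ ((s j : ℂ) * hexCenter y - (s j : ℂ) * triEmbed (x j))
              ((s j : ℂ) * hexCenter y' - (s j : ℂ) * triEmbed (x j)) ⊆
            Jset \ (Fset ∪ (⋃ i, {z : ℂ | infDist z (B i) < r i}) ∪
              ⋃ i, ({z : ℂ | z.im ≤ (P i).im} ∩ closedBall (P i) (R₁ - μ)))) ∧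
        JoinedIn (Jset \ (Fset ∪ (⋃ i, {z : ℂ | infDist z (B i) < r i}) ∪
            ⋃ i, ({z : ℂ | z.im ≤ (P i).im} ∩ closedBall (P i) (R₁ - μ))))
          ((s j : ℂ) * hexCenter a - (s j : ℂ) * triEmbed (x j)) ((s j : ℂ) * hexCenter b - (s j : ℂ) * triEmbed (x j)) := by
  intro Ω Jset Fset s x U τ B Bp r m P R₁ μ κ hs hs0 hτ hΩ hJo hJK hFb hFK hBp hH hBpne hBpb hBne hBb hr hμ hκ hup
  -- compactness constants
  set K : Set ℂ := closure ((fun z => z - τ) '' Ω) with hK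
  have hKc : IsCompact K := by
    refine (IsBounded.isCompact_closure ?_)
    obtain ⟨R', hR'⟩ := hΩ.subset_closedBall 0
    refine (isBounded_closedBall (x := -τ) (r := R')).subset ?_
    rintro _ ⟨z, hz, rfl⟩
    have := hR' hz
    rw [mem_closedBall, dist_eq_norm] at this ⊢
    simpa using this
  obtain ⟨c₁, hc₁, hc₁J⟩ := hKc.exists_thickening_subset_open hJo hJK
  obtain ⟨c₂, hc₂, hc₂F⟩ := hFK.exists_thickenings hFb.isCompact_closure isClosed_closure
  -- eventual facts
  have e1 : ∀ᶠ j in atTop, dist ((s j : ℂ) * triEmbed (x j)) τ + κ * s j < min c₁ c₂ := by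
    have : Tendsto (fun j => dist ((s j : ℂ) * triEmbed (x j)) τ + κ * s j) atTop (𝓝 (0 + κ * 0)) :=
      (tendsto_iff_dist_tendsto_zero.1 hτ).add (hs0.const_mul κ)
    rw [mul_zero, add_zero] at this
    exact this.eventually (gt_mem_nhds (lt_min hc₁ hc₂))
  have e2 : ∀ᶠ j in atTop, s j < μ := hs0.eventually (gt_mem_nhds hμ)
  have e3 : ∀ i, ∀ᶠ j in atTop, hausdorffDist (Bp i j) (B i) + κ * s j < m - r i := fun i => by
    have : Tendsto (fun j => hausdorffDist (Bp i j) (B i) + κ * s j) atTop (𝓝 (0 + κ * 0)) :=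
      (hH i).add (hs0.const_mul κ)
    rw [mul_zero, add_zero] at this
    exact this.eventually (gt_mem_nhds (by linarith [hr i]))
  have e3' : ∀ᶠ j in atTop, ∀ i, hausdorffDist (Bp i j) (B i) + κ * s j < m - r i := eventually_all.2 e3
  have e4 : ∀ᶠ j in atTop, ∀ i, ∀ v : HexVertex, (s j : ℂ) * hexCenter v - (s j : ℂ) * triEmbed (x j) ∈ ball (P i) R₁ →
      v ∉ U j → (P i).im < ((s j : ℂ) * hexCenter v - (s j : ℂ) * triEmbed (x j)).im := eventually_all.2 hup
  filter_upwards [e1, e2, e3', e4] with j hj1 hj2 hj3 hj4 a b w hwU ha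
  -- notation at level `j`
  set τj : ℂ := (s j : ℂ) * triEmbed (x j) with hτj
  set π : HexVertex → ℂ := fun y => (s j : ℂ) * hexCenter y - τj with hπ
  set X : Set ℂ := Fset ∪ (⋃ i, {z : ℂ | infDist z (B i) < r i}) ∪
    ⋃ i, ({z : ℂ | z.im ≤ (P i).im} ∩ closedBall (P i) (R₁ - μ)) with hX
  have hκs : s j ≤ κ * s j := le_mul_of_one_le_left (hs j).le hκ
  have hc₁' : dist τj τ + κ * s j < c₁ := hj1.trans_le (min_le_left _ _)
  have hc₂' : dist τj τ + κ * s j < c₂ := hj1.trans_le (min_le_right _ _)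
  have hvert : ∀ y ∈ w.support, (s j : ℂ) * hexCenter y ∈ closure Ω := smul_hexCenter_mem_closure_of_walk w ha
  -- a point `p` within `κ s_j` of a point `p₀` with `p₀ + τ_j ∈ closure Ω` is in `Jset` and off `Fset`
  have hJF : ∀ p p₀ : ℂ, p₀ + τj ∈ closure Ω → dist p p₀ ≤ κ * s j → p ∈ Jset ∧ p ∉ Fset := by
    intro p p₀ hp₀ hpp₀
    have hp' : p₀ + τj - τ ∈ K := by
      have hsub : (fun z => z - τ) '' closure Ω ⊆ K := image_closure_subset_closure_image (by fun_prop)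
      exact hsub ⟨p₀ + τj, hp₀, rfl⟩
    have hdist : dist p (p₀ + τj - τ) ≤ dist τj τ + κ * s j := by
      have h1 : dist p₀ (p₀ + τj - τ) = dist τj τ := by
        rw [dist_eq_norm, dist_comm, dist_eq_norm]; congr 1; ring
      linarith [dist_triangle p p₀ (p₀ + τj - τ)]
    have hpK1 : p ∈ thickening c₁ K := mem_thickening_iff.2 ⟨_, hp', hdist.trans_lt hc₁'⟩
    have hpK2 : p ∈ thickening c₂ K := mem_thickening_iff.2 ⟨_, hp', hdist.trans_lt hc₂'⟩
    refine ⟨hc₁J hpK1, fun hpF => ?_⟩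
    have : p ∈ thickening c₂ (closure Fset) := mem_thickening_iff.2 ⟨p, subset_closure hpF, by simp [hc₂]⟩
    exact Set.disjoint_left.1 hc₂F this hpK2
  -- a point within `κ s_j` of a present pinned vertex is off the body zones
  have hZ : ∀ p : ℂ, ∀ y ∈ w.support, dist p (π y) ≤ κ * s j → ∀ i, ¬ infDist p (B i) < r i := by
    intro p y hy hpy i hpi
    have hyU : infDist (π y) (Bp i j) > m := lt_of_not_ge fun h => hwU y hy (hBp i j y h)
    have hfin : Metric.hausdorffEDist (B i) (Bp i j) ≠ ⊤ :=
      hausdorffEDist_ne_top_of_nonempty_of_bounded (hBne i) (hBpne i j) (hBb i) (hBpb i j)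
    have h1 : infDist (π y) (Bp i j) ≤ infDist (π y) (B i) + hausdorffDist (B i) (Bp i j) :=
      infDist_le_infDist_add_hausdorffDist hfin
    have h2 : infDist (π y) (B i) ≤ infDist p (B i) + dist (π y) p := infDist_le_infDist_add_dist
    rw [hausdorffDist_comm] at h1
    rw [dist_comm] at h2
    linarith [hj3 i]
  -- vertices and segments are off the closed lower half-balls
  have hLvert : ∀ y ∈ w.support, ∀ i, π y ∉ {z : ℂ | z.im ≤ (P i).im} ∩ closedBall (P i) (R₁ - μ) := by
    intro y hy i ⟨him, hball⟩
    by_cases hin : π y ∈ ball (P i) R₁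
    · exact absurd (hj4 i y hin (hwU y hy)) (not_lt.2 him)
    · rw [mem_ball, not_lt] at hin
      have := mem_closedBall.1 hball
      linarith
  have hLseg : ∀ y ∈ w.support, ∀ y' ∈ w.support, dist (π y) (π y') ≤ s j →
      ∀ p ∈ segment ℝ (π y) (π y'), ∀ i, p ∉ {z : ℂ | z.im ≤ (P i).im} ∩ closedBall (P i) (R₁ - μ) := by
    intro y hy y' hy' hd p hp i ⟨him, hball⟩
    by_cases hin : π y ∈ ball (P i) R₁ ∧ π y' ∈ ball (P i) R₁
    · have h1 := hj4 i y hin.1 (hwU y hy)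
      have h2 := hj4 i y' hin.2 (hwU y' hy')
      have : p ∈ {z : ℂ | (P i).im < z.im} := (convex_halfSpace_im_gt _).segment_subset h1 h2 hp
      exact absurd (show (P i).im < p.im from this) (not_lt.2 him)
    · -- one endpoint `e` is outside `ball (P i) R₁`, and `p` is within `s_j` of it
      have hpball : ∀ e : ℂ, dist (π y) e ≤ s j → dist (π y') e ≤ s j → dist p e ≤ s j := fun e h1 h2 => by
        have := (convex_closedBall e (s j)).segment_subset (mem_closedBall.2 h1) (mem_closedBall.2 h2) hp
        exact mem_closedBall.1 this
      have hball' := mem_closedBall.1 hball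
      rcases not_and_or.1 hin with hout | hout
      · rw [mem_ball, not_lt] at hout
        have := hpball (π y) (by simp [(hs j).le]) (by rwa [dist_comm])
        linarith [dist_triangle (π y) p (P i), dist_comm p (π y)]
      · rw [mem_ball, not_lt] at hout
        have := hpball (π y') hd (by simp [(hs j).le])
        linarith [dist_triangle (π y') p (P i), dist_comm p (π y')]
  -- assemble
  have hπΩ : ∀ y ∈ w.support, π y + τj ∈ closure Ω := fun y hy => by simp [hπ]; exact hvert y hy
  have hpoint : ∀ y ∈ w.support, ∀ p : ℂ, dist p (π y) ≤ κ * s j → p ∈ Jset ∧ p ∉ Fset ∧ ∀ i, r i ≤ infDist p (B i) := by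
    intro y hy p hp
    obtain ⟨hJ, hF⟩ := hJF p (π y) (hπΩ y hy) hp
    exact ⟨hJ, hF, fun i => not_lt.1 (hZ p y hy hp i)⟩
  have hvertex : ∀ y ∈ w.support, π y ∈ Jset \ X := by
    intro y hy
    obtain ⟨hJ, hF, hB⟩ := hpoint y hy (π y) (by rw [dist_self]; exact mul_nonneg (by linarith) (hs j).le)
    refine ⟨hJ, ?_⟩
    rintro ((hF' | hZ') | hL')
    · exact hF hF'
    · obtain ⟨i, hi⟩ := mem_iUnion.1 hZ'
      exact absurd hi (not_lt.2 (hB i))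
    · obtain ⟨i, hi⟩ := mem_iUnion.1 hL'
      exact hLvert y hy i hi
  have hsegment : ∀ y ∈ w.support, ∀ y' ∈ w.support, (hexDomainGraph Ω (s j)).Adj y y' →
      segment ℝ (π y) (π y') ⊆ Jset \ X := by
    intro y hy y' hy' hadj p hp
    obtain ⟨hsegΩ, hlen⟩ := segment_subset_closure_of_adj (hs j).le hadj
    have hlen' : dist (π y) (π y') ≤ s j := by
      simp only [hπ]; rwa [dist_sub_right] 
    -- `p + τ_j` lies on the unpinned edge, inside `closure Ω`
    have hpΩ : p + τj ∈ closure Ω := by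
      refine hsegΩ ?_
      rw [segment_eq_image'] at hp ⊢
      obtain ⟨θ, hθ, rfl⟩ := hp
      refine ⟨θ, hθ, ?_⟩
      simp only [hπ]; ring
    obtain ⟨hJ, hF⟩ := hJF p p hpΩ (by rw [dist_self]; exact mul_nonneg (by linarith) (hs j).le)
    have hpy : dist p (π y) ≤ κ * s j := by
      have := (convex_closedBall (π y) (s j)).segment_subset (mem_closedBall_self (hs j).le)
        (mem_closedBall.2 (by rwa [dist_comm])) hp
      exact (mem_closedBall.1 this).trans hκs
    refine ⟨hJ, ?_⟩
    rintro ((hF' | hZ') | hL')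
    · exact hF hF'
    · obtain ⟨i, hi⟩ := mem_iUnion.1 hZ'
      exact hZ p y hy hpy i hi
    · obtain ⟨i, hi⟩ := mem_iUnion.1 hL'
      exact hLseg y hy y' hy' hlen' p hp i hi
  exact ⟨hpoint, hvertex, hsegment, joinedIn_of_walk π w (fun u v huv hu hv => hsegment u hu v hv huv)
    (hvertex a (SimpleGraph.Walk.start_mem_support _))⟩

end Summit.CriticalPhenomena.SAWScalingLimit.Theorems.ObservableToSLE.TypeLadder

end
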